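import Literature.AlgebraicGeometry.Hironaka2017.S16Proof.R095bLem167
import Literature.AlgebraicGeometry.Hironaka2017.Lib.SInclCoordCentre
import Literature.AlgebraicGeometry.Hironaka2017.Lib.SpecOrders
import Literature.RingTheory.MvPolynomial.VariableIdeals
import Summits.ResolutionOfSingularities.ResolutionOfSingularities.Theorems.MarkedTransferCampaignW21ChainWitnessSeries
import Mathlib.Algebra.CharP.Lemmas
import Mathlib.FieldTheory.Perfect
import HarnessLib

/-!
# [OURS · L1 W2.1] The two-level H♭ chain on the SCHEME `𝔸³_{𝔽_p}` — MODEL FILE (ambient datum, polynomial data, orders at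
# prime points, the origin / the point `(0,0,1)` / the generic point of the line `D = V(y,u)`); kernel K-R91-1, part 1 of 2

Rung L (rescue) of cell res-hironaka, RESCUE-SEED row L-G2, slot W2.1 (USE half), seat res-L1-s21-pv-1 (gen 3); kernel request
K-R91-1 of the adjudication (res-adj-1 GAP-AMEND R91 2026-08-27T06:34:11Z, res-plan-2 BOOKED 06:35:14Z, director-resolution CLASS
RULING R91 (3b) 06:40:10Z). The manuscript under adjudication is H. Hironaka, *Resolution of singularities in positive
characteristics*, 2017-03-23 (lit key `paper:url-3343fd9e678b`) [claim: Hironaka2017, status: under-review]; NOTHING of it is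
asserted or denied here: this file only BUILDS OUR data on the affine 3-space over `𝔽_p` as objects of the typed carriers (row
001 `AmbientDatum`, row 019 `sectionOrder`) — folklore constructions. The instance of row 019's `LLChain`, the centre and the
refutations of the typed `S16Proof.Lem16_7` / `U85L8` at it are in part 2, `…ChainScheme.lean`. AI-written; AI review is
weaker than expert review.

## Contents (namespace `…CampaignW21.ChainScheme`; every prime `p`; `y = X 0`, `u = X 1`, `v = X 2`)

* `amb p : AmbientDatum p 𝔽_p` — `Z = Spec 𝔽_p[y,u,v] → Spec 𝔽_p` (smooth, irreducible, affine); `perfectField_k`.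
* `sec = toΓ`: polynomials as global sections; `sectionOrder_sec` (row 019's `sectionOrder` of `sec r` = order of `(r)~`,
  `Lib/SpecOrders`), lower bounds `le/lt_sectionOrder_of_mem_pow(_succ)` (`r ∈ 𝔭ⁿ`), extraction `mem_of_one_le_sectionOrder`,
  `sectionOrder_eq_zero_of_not_mem`.
* The data `eps0 = y^{p²−1}u^{p²+1}v^{p²} + y^{p²−1}u v^{2p²} + u^{p²}v^{p³+p²+p}`, `eps1 = −v^{(p+1)²}`, `h0 = eps0 + v^{p³+2p²+p}`,
  `g0 = y^{p²} + eps0`, `g1 = y^p + eps1`; the chain identity `chain0 : g0 = g1^p + h0`; **`h0_coe_eq_hflat`: read in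
  `𝔽_p⟦y,u,v⟧`, `h0` IS the H♭ product `∂^{(p²−1,1,0)}ε₀ · ∂^{(0,p²,p²)}ε₀` of p504005 (`ChainWitness.hd_prod0`)**, `eps0_coe_eq`.
* Ideals `P = (y,u)` (`CoordChart.coordIdeal`), `𝔪 = (y,u,v)`: `g0 ∈ P^{p²}`, `eps0 ∈ P^{p²}`, `h0 ∉ P`, `g1 ∉ P`, `v^n ∉ P`;
  `g0 ∈ 𝔪^{p²}`, `eps0, h0 ∈ 𝔪^{p²+1}`, `eps1 ∈ 𝔪^{p+1}`.
* Points: the origin `ξ` (closed; `sectionOrder_X0_ξ : ord_ξ y = 1`), the point `pt = (0,0,1)` (`g1 ∉ 𝔭_pt`), the generic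
  point `η = (y,u)` of `D = V(y,u) = CoordChart.coordCentre 𝔽_p (Fin 3) {0,1}` (`isGenericPoint_η`); `ξ, pt, η ∈ D`.
-/

noncomputable section

set_option linter.dupNamespace false -- mandated namespace of this single-conjunct summit

namespace Summit.ResolutionOfSingularities.ResolutionOfSingularities.Theorems

namespace CampaignW21

open AlgebraicGeometry CategoryTheory MvPolynomial IsLocalRing TopologicalSpace
open Literature.AlgebraicGeometry.Resolution Scheme.IdealSheafData
open Literature.AlgebraicGeometry.Hironaka2017.S02Preliminaries
open Literature.AlgebraicGeometry.Hironaka2017.S02Preliminaries.CoordChart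
open Literature.AlgebraicGeometry.Hironaka2017.S16Proof
open Literature.AlgebraicGeometry.Hironaka2017.SpecOrders

namespace ChainScheme

variable (p : ℕ) [hp : Fact p.Prime]

/-! ## The ambient datum `𝔸³_{𝔽_p} → Spec 𝔽_p` -/

/-- the base field `𝔽_p` [folklore] -/
abbrev k : Type := ZMod p

/-- the polynomial ring `𝔽_p[y, u, v]` (`y = X 0`, `u = X 1`, `v = X 2`) [folklore] -/
abbrev A : Type := MvPolynomial (Fin 3) (k p)

/-- the affine space `Z = Spec 𝔽_p[y, u, v]` [folklore] -/
abbrev Z : Scheme.{0} := Spec (.of (A p))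

/-- The structure morphism `Z = Spec 𝔽_p[y,u,v] → Spec 𝔽_p`. [folklore] -/
def f : Z p ⟶ Spec (.of (k p)) := Spec.map (CommRingCat.ofHom (algebraMap (k p) (A p)))

/-- `Z → Spec 𝔽_p` is smooth (a polynomial algebra is a smooth algebra). [folklore] -/
theorem smooth_f : Smooth (f p) := by
  haveI : Algebra.Smooth (k p) (A p) := {}
  rw [f, HasRingHomProperty.Spec_iff (P := @Smooth), CommRingCat.hom_ofHom, RingHom.smooth_algebraMap]
  infer_instance

/-- `𝔸³_{𝔽_p} → Spec 𝔽_p` as a row-001 ambient datum (irreducible, smooth, quasi-compact). [folklore] -/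
def amb : AmbientDatum p (k p) where
  Z := Z p
  hom := f p
  irreducible := inferInstance
  smooth := smooth_f p
  quasiCompact := inferInstance

/-- `𝔽_p` is a perfect field (finite). [folklore] -/
theorem perfectField_k : PerfectField (k p) := by
  haveI : Fact (1 < p) := ⟨hp.out.one_lt⟩
  exact PerfectField.ofFinite

/-- Global sections of `Z` from polynomials: the ring isomorphism `𝔽_p[y,u,v] → Γ(Z, 𝒪_Z)`. [folklore] -/
abbrev sec : A p →+* Γ(Z p, ⊤) := toΓ (A p)

/-! ## Orders of principal ideals at prime points of `Spec 𝔽_p[y,u,v]` -/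

/-- The ideal sheaf `r·𝒪` of the section of a polynomial `r` is the sheaf of the principal ideal `(r)`. [folklore] -/
theorem principalIdealSheaf_sec (r : A p) : principalIdealSheaf (sec p r) = shf (A p) (Ideal.span {r}) := by
  rw [shf, Ideal.map_span, Set.image_singleton]

/-- Row 019's `sectionOrder` of the section of `r` at `𝔭` is the order of `(r)~` at `𝔭`. [folklore] -/
theorem sectionOrder_sec (r : A p) (x : Z p) :
    sectionOrder (sec p r) x = idealOrder (shf (A p) (Ideal.span {r})) x := by
  change idealOrder (principalIdealSheaf (sec p r)) x = _
  rw [principalIdealSheaf_sec]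

/-- Lower bound: `r ∈ 𝔭ⁿ ⇒ n ≤ ord_𝔭(r)`. [folklore] -/
theorem le_sectionOrder_of_mem_pow (x : Z p) (r : A p) (n : ℕ) (h : r ∈ x.asIdeal ^ n) :
    (n : ℕ∞) ≤ sectionOrder (sec p r) x := by
  rw [sectionOrder_sec]
  exact le_idealOrder_shf_of_le_pow (A p) _ x n ((Ideal.span_singleton_le_iff_mem _).mpr h)

/-- Strict lower bound: `r ∈ 𝔭ⁿ⁺¹ ⇒ n < ord_𝔭(r)`. [folklore] -/
theorem lt_sectionOrder_of_mem_pow_succ (x : Z p) (r : A p) (n : ℕ) (h : r ∈ x.asIdeal ^ (n + 1)) :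
    (n : ℕ∞) < sectionOrder (sec p r) x :=
  lt_of_lt_of_le (by exact_mod_cast Nat.lt_succ_self n) (le_sectionOrder_of_mem_pow p x r (n + 1) h)

/-- Upper-bound extraction: `1 ≤ ord_𝔭(r) ⇒ r ∈ 𝔭`. [folklore] -/
theorem mem_of_one_le_sectionOrder (x : Z p) (r : A p) (h : (1 : ℕ∞) ≤ sectionOrder (sec p r) x) :
    r ∈ x.asIdeal := by
  rw [sectionOrder_sec] at h
  obtain ⟨s, hs, hsr⟩ := exists_mul_mem_pow_of_le_idealOrder (A p) _ x 1 (by exact_mod_cast h) r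
    (Ideal.mem_span_singleton_self r)
  rw [pow_one] at hsr
  exact (x.2.mem_or_mem hsr).resolve_left hs

/-- `ord_𝔭(r) = 0` as soon as `r ∉ 𝔭`. [folklore] -/
theorem sectionOrder_eq_zero_of_not_mem (x : Z p) (r : A p) (h : r ∉ x.asIdeal) : sectionOrder (sec p r) x = 0 := by
  by_contra h0
  exact h (mem_of_one_le_sectionOrder p x r (Order.one_le_iff_ne_zero.mpr h0))

/-! ## The data: `ε₀, ε₁, h₀, g(0), g(1)` in `𝔽_p[y,u,v]` -/

/-- `ε₀ = y^{p²−1}u^{p²+1}v^{p²} + y^{p²−1}u v^{2p²} + u^{p²}v^{p³+p²+p}` (polynomial form of `ChainWitness.eps0`). [folklore] -/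
def eps0 : A p :=
  X 0 ^ (p ^ 2 - 1) * X 1 ^ (p ^ 2 + 1) * X 2 ^ (p ^ 2) + X 0 ^ (p ^ 2 - 1) * X 1 * X 2 ^ (2 * p ^ 2) +
    X 1 ^ (p ^ 2) * X 2 ^ (p ^ 3 + p ^ 2 + p)

/-- `ε₁ = −v^{(p+1)²}` (polynomial form of `ChainWitness.eps1`). [folklore] -/
def eps1 : A p := -(X 2 ^ (p ^ 2 + 2 * p + 1))

/-- `h₀ = ε₀ + v^{p³+2p²+p}` — the level-0 Case-(I) H♭ value (`h0_coe_eq_hflat`). [folklore] -/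
def h0 : A p := eps0 p + X 2 ^ (p ^ 3 + 2 * p ^ 2 + p)

/-- `g(0) = y^{p²} + ε₀`. [folklore] -/
def g0 : A p := X 0 ^ (p ^ 2) + eps0 p

/-- `g(1) = y^p + ε₁`. [folklore] -/
def g1 : A p := X 0 ^ p + eps1 p

/-- `p² − 1 + 1 = p²`. [folklore] -/
theorem sq_sub_one_add_one : p ^ 2 - 1 + 1 = p ^ 2 :=
  Nat.sub_add_cancel (Nat.one_le_pow _ _ hp.out.pos)

/-- **The chain identity at level 0 in `𝔽_p[y,u,v]`**: `g(0) = g(1)^p + h₀`. [folklore] -/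
theorem chain0 : g0 p = g1 p ^ p + h0 p := by
  rw [g1, add_pow_char _ _ p, ← pow_mul, ← sq, eps1, neg_pow, neg_one_pow_char (A p) p, ← pow_mul, h0, g0]
  have e1 : (p ^ 2 + 2 * p + 1) * p = p ^ 3 + 2 * p ^ 2 + p := by ring
  rw [e1]
  ring

/-- **The knock-out `h₀` IS the H♭ value** `∂^{(p²−1,1,0)}ε₀ · ∂^{(0,p²,p²)}ε₀` computed at the series level in p504005
(`ChainWitness.hd_prod0`): the polynomial `h₀`, read in `𝔽_p⟦y,u,v⟧`, equals that product of Hasse derivatives of `ε₀`. [folklore] -/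
theorem h0_coe_eq_hflat :
    ((h0 p : A p) : MvPowerSeries (Fin 3) (ZMod p)) =
      Literature.RingTheory.MvPowerSeries.hasseDeriv (AlongCentreWitness.e3 (ChainWitness.M p) 1 0) (ChainWitness.eps0 p) *
        Literature.RingTheory.MvPowerSeries.hasseDeriv (AlongCentreWitness.e3 0 (p ^ 2) (p ^ 2))
          (ChainWitness.eps0 p) := by
  rw [ChainWitness.hd_prod0, ← AlongCentreWitness.X2_pow_eq]
  have hM : ChainWitness.M p = p ^ 2 - 1 := by
    have := ChainWitness.M_add_one p
    omega
  simp only [h0, eps0, ChainWitness.eps0, hM, MvPolynomial.coe_add, MvPolynomial.coe_mul, MvPolynomial.coe_pow,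
    MvPolynomial.coe_X]

/-- The polynomial `ε₀`, read in `𝔽_p⟦y,u,v⟧`, is the series-level `ChainWitness.eps0` of p504005. [folklore] -/
theorem eps0_coe_eq : ((eps0 p : A p) : MvPowerSeries (Fin 3) (ZMod p)) = ChainWitness.eps0 p := by
  have hM : ChainWitness.M p = p ^ 2 - 1 := by
    have := ChainWitness.M_add_one p
    omega
  simp only [eps0, ChainWitness.eps0, hM, MvPolynomial.coe_add, MvPolynomial.coe_mul, MvPolynomial.coe_pow,
    MvPolynomial.coe_X]

/-! ## The ideals `𝔪 = (y,u,v)` (origin) and `P = (y,u)` (the line `D`); memberships -/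

/-- the variable set `{0, 1}` of the line `D = V(y, u)` [folklore] -/
def S : Set (Fin 3) := {0, 1}

/-- the prime `P = (y, u)` [folklore] -/
abbrev P : Ideal (A p) := coordIdeal (k p) (Fin 3) S

/-- `y ∈ P`. [folklore] -/
theorem X0_mem_P : (X 0 : A p) ∈ P p := Ideal.subset_span ⟨0, by simp [S], rfl⟩

/-- `u ∈ P`. [folklore] -/
theorem X1_mem_P : (X 1 : A p) ∈ P p := Ideal.subset_span ⟨1, by simp [S], rfl⟩

/-- `v^n ∉ P`. [folklore] -/
theorem X2_pow_not_mem_P (n : ℕ) : (X 2 : A p) ^ n ∉ P p := by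
  intro h
  rw [X_pow_eq_monomial] at h
  have h' := (mem_ideal_span_X_image.mp h) (Finsupp.single 2 n) (by
    classical
    rw [support_monomial, if_neg one_ne_zero]; exact Finset.mem_singleton_self _)
  obtain ⟨i, hi, hne⟩ := h'
  simp only [S, Set.mem_insert_iff, Set.mem_singleton_iff] at hi
  rcases hi with rfl | rfl
  · exact hne (by rw [Finsupp.single_eq_of_ne (by decide)])
  · exact hne (by rw [Finsupp.single_eq_of_ne (by decide)])

/-- `ε₀ ∈ P^{p²}` (every term has `(y,u)`-degree `≥ p²`). [folklore] -/
theorem eps0_mem_P_pow : eps0 p ∈ P p ^ (p ^ 2) := by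
  have hA : (X 0 : A p) ^ (p ^ 2 - 1) * X 1 ^ (p ^ 2 + 1) ∈ P p ^ (p ^ 2) :=
    Ideal.mul_mem_left _ _ (Ideal.pow_le_pow_right (Nat.le_succ _) (Ideal.pow_mem_pow (X1_mem_P p) _))
  have hB : (X 0 : A p) ^ (p ^ 2 - 1) * X 1 ∈ P p ^ (p ^ 2) := by
    have := Ideal.mul_mem_mul (Ideal.pow_mem_pow (X0_mem_P p) (p ^ 2 - 1)) (Ideal.pow_mem_pow (X1_mem_P p) 1)
    rw [← pow_add, pow_one, sq_sub_one_add_one] at this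
    exact this
  have hC : (X 1 : A p) ^ (p ^ 2) ∈ P p ^ (p ^ 2) := Ideal.pow_mem_pow (X1_mem_P p) _
  unfold eps0
  exact add_mem (add_mem (Ideal.mul_mem_right _ _ hA) (Ideal.mul_mem_right _ _ hB)) (Ideal.mul_mem_right _ _ hC)

/-- `ε₀ ∈ P`. [folklore] -/
theorem eps0_mem_P : eps0 p ∈ P p :=
  Ideal.pow_le_self (pow_ne_zero 2 hp.out.ne_zero) (eps0_mem_P_pow p)

/-- **`g(0) ∈ P^{p²}`**: `ord_D g(0) ≥ p²` at every point of `D`. [folklore] -/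
theorem g0_mem_P_pow : g0 p ∈ P p ^ (p ^ 2) :=
  add_mem (Ideal.pow_mem_pow (X0_mem_P p) _) (eps0_mem_P_pow p)

/-- `h₀ ∉ P` (`ord_D h₀ = 0`). [folklore] -/
theorem h0_not_mem_P : h0 p ∉ P p := by
  intro h
  have : (X 2 : A p) ^ (p ^ 3 + 2 * p ^ 2 + p) ∈ P p := by
    have := Ideal.sub_mem _ h (eps0_mem_P p)
    rwa [h0, add_sub_cancel_left] at this
  exact X2_pow_not_mem_P p _ this

/-- `g(1) ∉ P` (`ord_D g(1) = 0`). [folklore] -/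
theorem g1_not_mem_P : g1 p ∉ P p := by
  intro h
  have hy : (X 0 : A p) ^ p ∈ P p := Ideal.pow_mem_of_mem _ (X0_mem_P p) _ hp.out.pos
  have : (X 2 : A p) ^ (p ^ 2 + 2 * p + 1) ∈ P p := by
    have h1 := Ideal.sub_mem _ hy h
    rw [g1, eps1, sub_add_cancel_left, neg_neg] at h1
    exact h1
  exact X2_pow_not_mem_P p _ this

/-- the maximal ideal `𝔪 = (y, u, v)` of the origin [folklore] -/
abbrev 𝔪 : Ideal (A p) := idealOfVars (Fin 3) (k p)

/-- `X i ∈ 𝔪`. [folklore] -/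
theorem X_mem_𝔪 (i : Fin 3) : (X i : A p) ∈ 𝔪 p := Ideal.subset_span (Set.mem_range_self i)

/-- `P ≤ 𝔪`. [folklore] -/
theorem P_le_𝔪 : P p ≤ 𝔪 p := by
  refine Ideal.span_le.mpr ?_
  rintro _ ⟨i, -, rfl⟩
  exact X_mem_𝔪 p i

/-- `g(0) ∈ 𝔪^{p²}` (`ord_ξ g(0) ≥ p²`). [folklore] -/
theorem g0_mem_𝔪_pow : g0 p ∈ 𝔪 p ^ (p ^ 2) := Ideal.pow_right_mono (P_le_𝔪 p) _ (g0_mem_P_pow p)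

/-- `ε₀ ∈ 𝔪^{p²+1}` (`ord_ξ ε₀ > p²`; in fact `ord_ξ ε₀ = 3p²`). [folklore] -/
theorem eps0_mem_𝔪_pow : eps0 p ∈ 𝔪 p ^ (p ^ 2 + 1) := by
  have hp2 : 1 ≤ p ^ 2 := Nat.one_le_pow _ _ hp.out.pos
  have hA : (X 0 : A p) ^ (p ^ 2 - 1) * X 1 ^ (p ^ 2 + 1) * X 2 ^ (p ^ 2) ∈ 𝔪 p ^ (p ^ 2 + 1) :=
    Ideal.mul_mem_right _ _ (Ideal.mul_mem_left _ _ (Ideal.pow_mem_pow (X_mem_𝔪 p 1) _))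
  have hB : (X 0 : A p) ^ (p ^ 2 - 1) * X 1 * X 2 ^ (2 * p ^ 2) ∈ 𝔪 p ^ (p ^ 2 + 1) := by
    have h1 : (X 0 : A p) ^ (p ^ 2 - 1) * X 1 ∈ 𝔪 p ^ (p ^ 2) := by
      have := Ideal.mul_mem_mul (Ideal.pow_mem_pow (X_mem_𝔪 p 0) (p ^ 2 - 1)) (Ideal.pow_mem_pow (X_mem_𝔪 p 1) 1)
      rw [← pow_add, pow_one, sq_sub_one_add_one] at this
      exact this
    have h2 := Ideal.mul_mem_mul h1 (Ideal.pow_mem_pow (X_mem_𝔪 p 2) (2 * p ^ 2))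
    rw [← pow_add] at h2
    exact Ideal.pow_le_pow_right (by omega) h2
  have hC : (X 1 : A p) ^ (p ^ 2) * X 2 ^ (p ^ 3 + p ^ 2 + p) ∈ 𝔪 p ^ (p ^ 2 + 1) := by
    have h2 := Ideal.mul_mem_mul (Ideal.pow_mem_pow (X_mem_𝔪 p 1) (p ^ 2))
      (Ideal.pow_mem_pow (X_mem_𝔪 p 2) (p ^ 3 + p ^ 2 + p))
    rw [← pow_add] at h2
    exact Ideal.pow_le_pow_right (by have := hp.out.pos; omega) h2
  unfold eps0
  exact add_mem (add_mem hA hB) hC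

/-- `h₀ ∈ 𝔪^{p²+1}` (`ord_ξ h₀ > p²`). [folklore] -/
theorem h0_mem_𝔪_pow : h0 p ∈ 𝔪 p ^ (p ^ 2 + 1) := by
  refine add_mem (eps0_mem_𝔪_pow p) (Ideal.pow_le_pow_right ?_ (Ideal.pow_mem_pow (X_mem_𝔪 p 2) _))
  have := hp.out.pos
  nlinarith

/-- `ε₁ ∈ 𝔪^{p+1}` (`ord_ξ ε₁ = (p+1)² > p`). [folklore] -/
theorem eps1_mem_𝔪_pow : eps1 p ∈ 𝔪 p ^ (p + 1) := by
  rw [eps1]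
  refine neg_mem (Ideal.pow_le_pow_right ?_ (Ideal.pow_mem_pow (X_mem_𝔪 p 2) _))
  nlinarith

/-! ## Points: the origin `ξ`, the point `(0,0,1)` of `D`, the generic point `η = (y,u)` of `D` -/

/-- the origin `ξ = (y, u, v)` [folklore] -/
abbrev ξ : Z p := origin (k p) (Fin 3)

/-- The origin is a closed point (row 001 `closedPoints`). [folklore] -/
theorem ξ_closed : ξ p ∈ Literature.AlgebraicGeometry.Hironaka2017.S02Preliminaries.closedPoints (Z p) := isClosed_origin

/-- `ord_ξ(y) ≤ 1`: `y ∉ 𝔪²·𝒪_ξ` (if `s·y ∈ 𝔪²` with `s(0) ≠ 0`, compare the coefficients of `y`). [folklore] -/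
theorem not_two_le_sectionOrder_X0_ξ : ¬ (2 : ℕ∞) ≤ sectionOrder (sec p (X 0)) (ξ p) := by
  intro h
  rw [sectionOrder_sec] at h
  obtain ⟨s, hs, hsy⟩ := exists_mul_mem_pow_of_le_idealOrder (A p) _ (ξ p) 2 (by exact_mod_cast h) (X 0)
    (Ideal.mem_span_singleton_self _)
  change s ∉ 𝔪 p at hs
  change s * X 0 ∈ 𝔪 p ^ 2 at hsy
  rw [mem_pow_idealOfVars_iff'] at hsy
  have h1 := hsy (Finsupp.single 0 1) (by rw [Finsupp.degree_single]; norm_num)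
  classical
  rw [coeff_mul_X', if_pos (by simp), tsub_self] at h1
  apply hs
  rw [← pow_one (𝔪 p), mem_pow_idealOfVars_iff']
  intro m hm
  have hm0 : m = 0 := (Finsupp.degree_eq_zero_iff m).mp (Nat.lt_one_iff.mp hm)
  subst hm0
  exact h1

/-- **`ord_ξ(y) = 1`** («ending with `ord_ξ(g(e)) = 1`»). [folklore] -/
theorem sectionOrder_X0_ξ : sectionOrder (sec p (X 0)) (ξ p) = 1 := by
  apply le_antisymm
  · by_contra h
    apply not_two_le_sectionOrder_X0_ξ p
    have : (1 : ℕ∞) < sectionOrder (sec p (X 0)) (ξ p) := not_le.mp h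
    exact (ENat.add_one_le_iff (by decide)).mpr this
  · have := le_sectionOrder_of_mem_pow p (ξ p) (X 0) 1 (by rw [pow_one]; exact X_mem_𝔪 p 0)
    exact_mod_cast this

/-- evaluation at the point `(y,u,v) = (0,0,1)` [folklore] -/
def ev001 : A p →+* k p := MvPolynomial.eval ![0, 0, 1]

/-- The kernel of the evaluation at `(0,0,1)` is a maximal ideal. [folklore] -/
theorem isMaximal_ker_ev001 : (RingHom.ker (ev001 p)).IsMaximal :=
  RingHom.ker_isMaximal_of_surjective _ fun c => ⟨C c, MvPolynomial.eval_C c⟩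

/-- the point `(0,0,1)` of `Z` (it lies on `D = V(y,u)`) [folklore] -/
def pt : Z p := ⟨RingHom.ker (ev001 p), (isMaximal_ker_ev001 p).isPrime⟩

/-- `P ≤ 𝔭_{(0,0,1)}`: the point `(0,0,1)` lies on `V(y,u)`. [folklore] -/
theorem P_le_pt : P p ≤ (pt p).asIdeal := by
  refine Ideal.span_le.mpr ?_
  rintro _ ⟨i, hi, rfl⟩
  simp only [S, Set.mem_insert_iff, Set.mem_singleton_iff] at hi
  change ev001 p (X i) = 0
  rcases hi with rfl | rfl <;> simp [ev001]

/-- `g(1) = y^p − v^{(p+1)²}` does not vanish at `(0,0,1)` (value `−1`). [folklore] -/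
theorem g1_not_mem_pt : g1 p ∉ (pt p).asIdeal := by
  change ¬ ev001 p (g1 p) = 0
  simp [ev001, g1, eps1, zero_pow hp.out.ne_zero]

/-- the generic point `η = (y, u)` of `D` [folklore] -/
def η : Z p := ⟨P p, Literature.RingTheory.MvPolynomial.isPrime_span_X_image S⟩

/-! ## The centre `D = V(y, u)` -/

/-- the centre `D = V(y, u)` (a coordinate line, `CoordChart.coordCentre`) [folklore] -/
abbrev D : Closeds (Z p) := coordCentre (k p) (Fin 3) S

/-- `ξ ∈ D`. [folklore] -/
theorem ξ_mem_D : ξ p ∈ (D p : Set (Z p)) := (mem_coordCentre_iff S _).mpr (P_le_𝔪 p)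

/-- `(0,0,1) ∈ D`. [folklore] -/
theorem pt_mem_D : pt p ∈ (D p : Set (Z p)) := (mem_coordCentre_iff S _).mpr (P_le_pt p)

/-- `η ∈ D`. [folklore] -/
theorem η_mem_D : η p ∈ (D p : Set (Z p)) := (mem_coordCentre_iff S _).mpr le_rfl

/-- specialisation in `Spec A` is containment of primes. [folklore] -/
theorem specializes_iff_le (x y : Z p) : x ⤳ y ↔ x.asIdeal ≤ y.asIdeal :=
  (PrimeSpectrum.le_iff_specializes x y).symm

/-- **`η = (y,u)` is the generic point of `D = V(y,u)`** (row 095b's rendering of «ord_D»). [folklore] -/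
theorem isGenericPoint_η : IsGenericPoint (η p) (D p : Set (Z p)) := by
  rw [isGenericPoint_def]
  ext x
  rw [← specializes_iff_mem_closure, specializes_iff_le, SetLike.mem_coe, mem_coordCentre_iff]
  exact Iff.rfl

end ChainScheme

end CampaignW21

end Summit.ResolutionOfSingularities.ResolutionOfSingularities.Theorems

end
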